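import Mathlib
import Summits.Ventures.PercRepro2.OneEdge
import Summits.Ventures.PercRepro2.KPrimeReduction
import Summits.Ventures.PercRepro2.KPrimeSure
import Summits.Ventures.PercRepro2.KPrimeEdgeSteps

/-!
# A pendant vertex `v` at `z`: flip invariance of the `z`-events and the `v`/`z` dictionary
(blind cell PercRepro2, mine-c g33; `conjectures/MINE-C.md` §42.3, §42.5)

Let `v` be a LEAF: its only edge is `e = {v, z}`.  Two facts make the pendant step of the
`v`-exploration of `(K′)` computable:

* with `e` pinned CLOSED, `v` is isolated (`conn_eq_of_isolated`), so every event among the other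
  vertices is FLIP-INVARIANT at `e` (`FlipInvAt`; `flipInvAt_connEvent`, `flipInvAt_avoidAll`) and
  has the same mass with `e` pinned open or closed;
* with `e` pinned OPEN, `v` is connected exactly to what `z` is connected to
  (`conn_v_iff_conn_z_of_mem_sureSet_update_one`): the `v`-events of the instance are the
  `z`-events.
-/

namespace Summit.Ventures.PercRepro2

namespace KPrime

variable {V : Type*} {E : Type*} [Fintype E] [DecidableEq E] [Fintype V] [DecidableEq V]
  {R : Type*} [Field R] [LinearOrder R] [IsStrictOrderedRing R]

section Pendant

variable {ends : E → Sym2 V} {v z : V} {p : E → R} {e : E}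

omit [Fintype E] [DecidableEq E] [Fintype V] [DecidableEq V] [Field R] [LinearOrder R]
  [IsStrictOrderedRing R] in
/-- A vertex whose only edge is closed is isolated: anything connected to it is itself. -/
lemma conn_eq_of_isolated (hleaf : ∀ f, v ∈ ends f → f = e) {ω : Config E} (hωe : ω e = false)
    {x : V} (h : Conn ends ω v x) : x = v := by
  have hS : ∀ a ∈ ({v} : Set V), ∀ y, (openGraph ends ω).Adj a y → y ∈ ({v} : Set V) := by
    intro a ha y hay
    rw [Set.mem_singleton_iff] at ha
    subst ha
    rw [openGraph_adj] at hay
    obtain ⟨_, f, hf, hends⟩ := hay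
    have hfe : f = e := hleaf f (by rw [hends]; exact Sym2.mem_mk_left _ _)
    rw [hfe, hωe] at hf
    exact absurd hf Bool.false_ne_true
  exact Set.mem_singleton_iff.1 (mem_of_conn_of_closed hS (Set.mem_singleton v) h)

omit [Fintype E] [Fintype V] [DecidableEq V] [Field R] [LinearOrder R] [IsStrictOrderedRing R] in
/-- Opening the pendant edge does not change connections among the other vertices. -/
lemma conn_update_true_pendant_iff (hleaf : ∀ f, v ∈ ends f → f = e) (hends : ends e = s(v, z))
    {ω : Config E} (hωe : ω e = false) {s x : V} (hs : s ≠ v) (hx : x ≠ v) :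
    Conn ends (Function.update ω e true) s x ↔ Conn ends ω s x := by
  rw [OneEdge.conn_update_true_iff hends]
  constructor
  · rintro (h | ⟨h1, _⟩ | ⟨_, h2⟩)
    · exact h
    · exact absurd (conn_eq_of_isolated hleaf hωe (conn_symm h1)) hs
    · exact absurd (conn_eq_of_isolated hleaf hωe h2) hx
  · exact fun h => Or.inl h

/-- An event is FLIP-INVARIANT at `e` (for `p`): on the weight-`1` edges of `p` being open, it does
not depend on the state of `e`. -/
def FlipInvAt (p : E → R) (e : E) (A : Set (Config E)) : Prop :=
  ∀ ω : Config E, oneConfig p ≤ ω →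
    (Function.update ω e true ∈ A ↔ Function.update ω e false ∈ A)

omit [Fintype E] [Fintype V] [DecidableEq V] [IsStrictOrderedRing R] in
/-- Flip invariance is closed under intersection. -/
lemma FlipInvAt.inter {A B : Set (Config E)} (hA : FlipInvAt p e A) (hB : FlipInvAt p e B) :
    FlipInvAt p e (A ∩ B) := fun ω hω => by
  simp only [Set.mem_inter_iff]; rw [hA ω hω, hB ω hω]

omit [Fintype E] [Fintype V] [DecidableEq V] [IsStrictOrderedRing R] in
/-- Flip invariance is closed under union. -/
lemma FlipInvAt.union {A B : Set (Config E)} (hA : FlipInvAt p e A) (hB : FlipInvAt p e B) :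
    FlipInvAt p e (A ∪ B) := fun ω hω => by
  simp only [Set.mem_union]; rw [hA ω hω, hB ω hω]

omit [Fintype E] [Fintype V] [DecidableEq V] [IsStrictOrderedRing R] in
/-- Flip invariance is closed under complement. -/
lemma FlipInvAt.compl {A : Set (Config E)} (hA : FlipInvAt p e A) : FlipInvAt p e Aᶜ :=
  fun ω hω => by simp only [Set.mem_compl_iff]; rw [hA ω hω]

omit [Fintype E] [Fintype V] [DecidableEq V] [IsStrictOrderedRing R] in
/-- A connection event between two vertices other than the leaf `v` is flip-invariant at the
pendant edge. -/
lemma flipInvAt_connEvent (hleaf : ∀ f, v ∈ ends f → f = e) (hends : ends e = s(v, z))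
    {s x : V} (hs : s ≠ v) (hx : x ≠ v) :
    FlipInvAt p e (connEvent ends s x) := by
  intro ω _
  set ω' := Function.update ω e false with hω'
  have hωe : ω' e = false := by simp [hω']
  have heq : Function.update ω e true = Function.update ω' e true := by
    simp [hω', Function.update_idem]
  rw [heq]
  simp only [mem_connEvent]
  exact conn_update_true_pendant_iff hleaf hends hωe hs hx

omit [Fintype E] [Fintype V] [DecidableEq V] [IsStrictOrderedRing R] in
/-- An avoidance event among vertices other than the leaf `v` is flip-invariant at the pendant
edge. -/
lemma flipInvAt_avoidAll (hleaf : ∀ f, v ∈ ends f → f = e) (hends : ends e = s(v, z))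
    {s : V} (hs : s ≠ v) {X : Finset V} (hX : ∀ x ∈ X, x ≠ v) :
    FlipInvAt p e (avoidAll ends s X) := by
  intro ω hω
  simp only [avoidAll, Set.mem_setOf_eq]
  constructor
  · intro h x hxX hc
    exact h x hxX ((flipInvAt_connEvent hleaf hends hs (hX x hxX) ω hω).2 hc)
  · intro h x hxX hc
    exact h x hxX ((flipInvAt_connEvent hleaf hends hs (hX x hxX) ω hω).1 hc)

omit [Fintype V] [DecidableEq V] [IsStrictOrderedRing R] in
/-- A flip-invariant event has the same mass with `e` pinned open and pinned closed. -/
lemma prob_update_one_eq_update_zero_of_flipInvAt (he : p e ≠ 1) {A : Set (Config E)}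
    (hA : FlipInvAt p e A) :
    prob (Function.update p e 1) A = prob (Function.update p e 0) A :=
  prob_update_one_eq_update_zero he hA

omit [Fintype E] [Fintype V] [DecidableEq V] [LinearOrder R] [IsStrictOrderedRing R] in
/-- With the pendant edge pinned open, `v` is connected exactly to what `z` is connected to. -/
lemma conn_v_iff_conn_z_of_mem_sureSet_update_one (hleaf : ∀ f, v ∈ ends f → f = e)
    (hends : ends e = s(v, z)) (hvz : v ≠ z) {ω : Config E}
    (hω : ω ∈ sureSet (Function.update p e 1)) {a : V} (ha : a ≠ v) :
    Conn ends ω a v ↔ Conn ends ω a z := by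
  have h1 : ω e = true := hω.1 e (by simp)
  have hvz' : Conn ends ω v z := conn_of_openAdj ⟨e, h1, hends⟩
  constructor
  · intro h
    have hS : ∀ x ∈ ({v} ∪ {w | Conn ends ω z w} : Set V), ∀ y,
        (openGraph ends ω).Adj x y → y ∈ ({v} ∪ {w | Conn ends ω z w} : Set V) := by
      intro x hx y hxy
      rw [openGraph_adj] at hxy
      obtain ⟨_, f, hf, hends'⟩ := hxy
      rcases hx with hx | hx
      · rw [Set.mem_singleton_iff] at hx
        have hfe : f = e := hleaf f (by rw [hends', hx]; exact Sym2.mem_mk_left _ _)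
        rw [hfe, hends, hx] at hends'
        rcases Sym2.eq_iff.1 hends' with ⟨_, hzy⟩ | ⟨_, hzv⟩
        · exact Or.inr (hzy ▸ conn_refl _ _ _)
        · exact absurd hzv.symm hvz
      · exact Or.inr (conn_trans hx (conn_of_openAdj ⟨f, hf, hends'⟩))
    have := mem_of_conn_of_closed hS (Or.inl (Set.mem_singleton v)) (conn_symm h)
    rcases this with h' | h'
    · exact absurd (Set.mem_singleton_iff.1 h') ha
    · exact conn_symm h'
  · intro h
    exact conn_trans h (conn_symm hvz')

end Pendant

end KPrime

end Summit.Ventures.PercRepro2
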